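/-
Copyright (c) 2026 the pub-hodgecm-mathlib formalisation cell (harness21).  Prover seat hodgecm-mathlib-K2E1-p16 (g2), Track B «K2-LIT» ENGINE E1, h413 = `stmt-HodgeConjecture-24833`,
route `HCCMUnconditional`, R90-S8 «ContSpec-n½» TWIN-DAG row 5 part 3 (dealer R90-CS-plan (g2), S8-R19) — the `N = 3` twin of ★ `K2E1ChiEisensteinBallPackageCMTwoEigen` (K2-defs1):
GENERIC-EIGENVALUE EDITION of ★ row 5 part 2 `K2E1ChiEisensteinBallPackageCMThreeScalar` with `ŝ_i(z)` for `∫ h_i·H^z`.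
-/
import Summits.HodgeConjecture.HodgeConjecture.Theorems.K2E1ChiEisensteinDataCMThree                 -- ★ row 4 (R90-C14-p01, p862005): `exists_chiPair_constantTerm_data_cm_three` (PAIR currency)
import Summits.HodgeConjecture.HodgeConjecture.Theorems.K2E1ChiEisensteinMeromorphicExportsU2Eigen   -- ★ p860174 (K2E1-p14, rank-generic): `exists_chi_xSystem_byproducts_of_eigen` (`σ₀ := 2`)
import Summits.HodgeConjecture.HodgeConjecture.Theorems.K2E1ChiUniquenessHunqCMThreeEigen            -- ★ (this seat): `hunq_chi_cm_three_of_eigen`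
import Summits.HodgeConjecture.HodgeConjecture.Theorems.K2E1ChiEisensteinHeckeMatrixU2               -- ★ row 10 (rank-generic file): `integral_mul_eisensteinSeriesU_flatSectionU_eq_cm_three`
import Summits.HodgeConjecture.HodgeConjecture.Theorems.K2E1SphericalEisensteinSolvesXSystemU3Head   -- ★ `quotFun_inv_smul_toAutomorphicQuotient_three`, `shiftOperatorX_toHX_eisensteinSeriesU_eq_smul_cm_three`
import Summits.HodgeConjecture.HodgeConjecture.Theorems.K2E1SphericalEisensteinMeromorphicExportsU3   -- ★ X1₃ (template): `hK1_cm_three_of`, `iotaBound_cm_three`, `measure_setOf_lt_ne_top_cm_three`, `isFiniteMeasure_weightedTruncMeasure_cm_three`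
import HarnessLib

/-!
# h413 ∕ Track B «K2-LIT», R90-S8 TWIN-DAG row 5 part 3 — `K2E1ChiEisensteinBallPackageCMThreeEigen`: GENERIC-EIGENVALUE EDITION of ★ `exists_chiPair_ball_package_cm_three_of_letters'`
# (row 5 part 2): the per-ball MEROMORPHIC PACKAGE of the `(χ₁, χ₂)` Eisenstein series `E(f_z^φ)` on `U(2,1)_{L∕L⁺}` with its scalar pieces (R4), on the convolution data, with every
# spherical transform `∫ h_i·H^z dν_G` replaced by the ENTIRE eigenvalue `ŝ_i(z)`

Cell `pub/hodgecm-mathlib`, crux H413 = `stmt-HodgeConjecture-24833`; dealer R90-CS-plan (g2) S8-R19 «row 5 parts 2–3 = K2E1-p16».  THEOREMS ONLY (no `def`, no `instance`, no notation,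
no named-fact hypothesis, no `sorry`); lane `--kind proof --supports stmt-HodgeConjecture-24833 --as helper` (count-neutral).  Closes no socket.  THIS FILE = the ★ `N = 2` eigen edition
(`K2E1ChiEisensteinBallPackageCMTwoEigen.exists_chi_ball_package_cm_two_of_eigen`) re-keyed token for token (`2 ↦ 3`, weight `n+3 ↦ n+4`, `1 < Re ↦ 2 < Re`, `1 − z ↦ 2 − z`, `σ₀ = 1 ↦ 2`,
`+ (hn : 0 < n)`, no trace-zero `δ`) in the PAIR CURRENCY of ★ row 4 (`φ` a continuous bounded `(χ₁, χ₂)`-section, `χ₂` automorphic; columns `φ′_j` `(χ₁′, χ₂′)`-sections, `χ₂′`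
automorphic): binders `(ŝ : I → ℂ → ℂ) (hŝ : ∀ i, Differentiable ℂ (ŝ i)) (hnc : ∃ z₁ z₂, ŝ i₀ z₁ ≠ ŝ i₀ z₂)`, `hcov : ∀ z ∈ ball, ∃ i, ŝ i z ≠ 0`, the scalar-action letter
`hS1 : ∫ h_i y·f_z^φ(x y) = ŝ_i(z)·f_z^φ(x)` (`2 < Re z`) — EXACTLY ★ convData_χ's action clause; suppliers ★ `exists_chi_xSystem_byproducts_of_eigen` (rank-generic, `σ₀ := 2`) and ★
`hunq_chi_cm_three_of_eigen`; everything else as in ★ row 5 part 2 (★ `hK1_cm_three_of` ∘ ★ `map_conj_toAdelic_eq_self_three`, ★ row 4 `exists_chiPair_constantTerm_data_cm_three`, ★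
`integral_mul_eisensteinSeriesU_flatSectionU_eq_cm_three`, ★ `shiftOperatorX_toHX_eisensteinSeriesU_eq_smul_cm_three`, ★ `eisensteinSeriesU_flatSectionU_quotientSubgroup_mul_of_borelU_invariant` ∘ ★
`IsChiSectionPair.toAdelic_mul`, ★ `eisensteinSeriesU_flatSectionU_memHX_of_norm_le_cm_three`).  [BernsteinLapid2019, Thm 2.3, §2.1, §4, §7; MoeglinWaldspurger1995, IV.1.8–IV.1.11]
* HEAD **`exists_chiPair_ball_package_cm_three_of_eigen`**.
HONEST LABEL: HC_CM is proved only modulo the 7 printed citations (2 remaining named inputs: hLiu418 = `stmt-HodgeConjecture-24832`, h413 = `stmt-HodgeConjecture-24833`) until rung 0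
closes; count-neutral helper, closes no socket; the letter `hS1` is NOT proved here.

## References
* [BernsteinLapid2019] J. Bernstein, E. Lapid, *On the meromorphic continuation of Eisenstein series*, J. AMS 37 (2024), Thm 2.3, §2.1, §4, §7.
* [MoeglinWaldspurger1995] C. Mœglin, J.-L. Waldspurger, *Spectral Decomposition and Eisenstein Series* (1995), IV.1.8–IV.1.11.
-/

set_option autoImplicit false
set_option linter.dupNamespace false  -- the mandated namespace repeats the summit's segment (`HodgeConjecture.HodgeConjecture`)

noncomputable section

open MeasureTheory Measure Filter Topology Set NumberField IsDedekindDomain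
open scoped NNReal ENNReal Classical ComplexConjugate
open Literature.MeasureTheory.Group Literature.NumberTheory Literature.NumberTheory.Automorphic Literature.NumberTheory.Automorphic.UnitaryGroup AdelicGroupData
open Literature.NumberTheory.Automorphic.Arthur2013.Leaves.TECR
open Literature.NumberTheory.GaloisRepresentations (HeckeCharacter)
open Summit.HodgeConjecture.HodgeConjecture.Cruxes.H413.K2E1BorelEisensteinU
open Summit.HodgeConjecture.HodgeConjecture.Cruxes.H413.K2E1BLBorelSpacesU2Defs
open Summit.HodgeConjecture.HodgeConjecture.Cruxes.H413.K2E1BLBorelOperatorsU2Defs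
open Summit.HodgeConjecture.HodgeConjecture.Cruxes.H413.K2E1CharacterEisensteinU2Defs
open Summit.HodgeConjecture.HodgeConjecture.Cruxes.H413.K2E1ChiSectionSpaceU2Defs
open Summit.HodgeConjecture.HodgeConjecture.Cruxes.H413.K2E1ChiEisensteinDataCMThree (exists_chiPair_constantTerm_data_cm_three)
open Summit.HodgeConjecture.HodgeConjecture.Cruxes.H413.K2E1ChiEisensteinMeromorphicExportsU2Eigen (exists_chi_xSystem_byproducts_of_eigen)
open Summit.HodgeConjecture.HodgeConjecture.Cruxes.H413.K2E1ChiUniquenessHunqCMThreeEigen (hunq_chi_cm_three_of_eigen)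
open Summit.HodgeConjecture.HodgeConjecture.Cruxes.H413.K2E1ChiEisensteinHeckeMatrixU2 (integral_mul_eisensteinSeriesU_flatSectionU_eq_cm_three)
open Summit.HodgeConjecture.HodgeConjecture.Cruxes.H413.K2E1ChiEisensteinSolvesXSystemU3 (eisensteinSeriesU_flatSectionU_quotientSubgroup_mul_of_borelU_invariant)
open Summit.HodgeConjecture.HodgeConjecture.Cruxes.H413.K2E1SphericalEisensteinSolvesXSystemU3 (quotFun_inv_smul_toAutomorphicQuotient_three shiftOperatorX_toHX_eisensteinSeriesU_eq_smul_cm_three)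
open Summit.HodgeConjecture.HodgeConjecture.Cruxes.H413.K2E1ChiFlatSectionHNHolomorphicU2 (norm_zFun_le zFun_flatSectionU)
open Summit.HodgeConjecture.HodgeConjecture.Cruxes.H413.K2E1ChiConstantTermColumnsIndependentU2 (coeFn_sum_smul_ae_eq)
open Summit.HodgeConjecture.HodgeConjecture.Cruxes.H413.K2E1ChiHomogeneousL2U2 (exists_ae_norm_deltaShift_le_of_ae_eq_mul_cpow)
open Summit.HodgeConjecture.HodgeConjecture.Cruxes.H413.K2E1BLHeckeOperatorHXU2 (convX_congr_ae)
open Summit.HodgeConjecture.HodgeConjecture.Cruxes.H413.K2E1BLHeckeOperatorHXU2Op (ae_withDensity_weightX_iff)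
open Summit.HodgeConjecture.HodgeConjecture.Cruxes.H413.K2E1BLIotaClosedEmbeddingU3 (iotaBound_cm_three isFiniteMeasure_weightedTruncMeasure_cm_three)
open Summit.HodgeConjecture.HodgeConjecture.Cruxes.H413.K2E1SphericalEisensteinMeromorphicSuppliersU3 (measure_setOf_lt_ne_top_cm_three)
open Summit.HodgeConjecture.HodgeConjecture.Cruxes.H413.K2E1BLQuotientMeasureU (measurePreserving_rightShift_of_unfolding)
open Summit.HodgeConjecture.HodgeConjecture.Cruxes.H413.K2E1IntertwinedSectionInvariance (map_conj_toAdelic_eq_self_three)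
open Summit.HodgeConjecture.HodgeConjecture.Cruxes.H413.K2E1BLEvaluationFunctionalU2 (exists_evalCLM)
open Summit.HodgeConjecture.HodgeConjecture.Cruxes.H413.K2E1BLLiftIntegrabilityU (quotFun_lift lift_quotientSubgroup_mul)
open Summit.HodgeConjecture.HodgeConjecture.Cruxes.H413.K2E1ChiEisensteinMemHXCMThree (eisensteinSeriesU_flatSectionU_memHX_of_norm_le_cm_three)
open Summit.HodgeConjecture.HodgeConjecture.Cruxes.H413.K2E1CharacterEisensteinU3PairDefs (IsChiSectionPair)

namespace Summit.HodgeConjecture.HodgeConjecture.Cruxes.H413.K2E1ChiEisensteinBallPackageCMThreeEigen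

variable (L : Type) [Field L] [NumberField L] [IsCMField L]
  [MeasurableSpace (quasiSplit (↥(maximalRealSubfield L)) L (IsCMField.complexConj L) 3).Adelic] [BorelSpace (quasiSplit (↥(maximalRealSubfield L)) L (IsCMField.complexConj L) 3).Adelic]

set_option maxHeartbeats 400000 in
/-- **X1_χ §2c — THE PER-BALL MEROMORPHIC PACKAGE OF `E(f_z^φ)` WITH ITS SCALAR PIECES (R4)** (module docstring): on the ball's convolution data (binders, ★ convData clauses) and the scalar-action letter `hS1`,
the co-discrete `U`, `v_X` and the scattering coordinates `cc` holomorphic on `U` ∕ meromorphic on `ball 0 (n+2)`, the eigen-equations, the α-system with uniqueness on `U`, and the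
Godement agreement `v_X =ᵐ [E(f_z^φ)]`, `cc = bX` on `U ∩ {2 < Re}`, and per `g` the meromorphic scalar piece `Ec_g` with its germs in integral form.
[cite: BernsteinLapid2019, Thm 2.3, §4 Claims 1–5, p. 10, §7] [cite: MoeglinWaldspurger1995, IV.1.8–IV.1.9] -/
theorem exists_chiPair_ball_package_cm_three_of_eigen
    (μ : Measure (quasiSplit (↥(maximalRealSubfield L)) L (IsCMField.complexConj L) 3).automorphicQuotient) [(quasiSplit (↥(maximalRealSubfield L)) L (IsCMField.complexConj L) 3).IsAutomorphicMeasure μ]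
    (νG : Measure (quasiSplit (↥(maximalRealSubfield L)) L (IsCMField.complexConj L) 3).Adelic) [νG.IsHaarMeasure] [νG.IsInvInvariant] [SFinite νG]
    (ν : Measure ↥(adelicUnipotent (↥(maximalRealSubfield L)) L (IsCMField.complexConj L) 3)) [ν.IsHaarMeasure] [ν.IsMulRightInvariant] [ν.IsInvInvariant]
    {𝓕 : Set ↥(adelicUnipotent (↥(maximalRealSubfield L)) L (IsCMField.complexConj L) 3)}
    (h𝓕N : IsFundamentalDomain ↥(rationalUnipotent (↥(maximalRealSubfield L)) L (IsCMField.complexConj L) 3) 𝓕 ν) (h𝓕c : IsCompact (closure 𝓕)) (h𝓕₀ : ν 𝓕 ≠ 0)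
    {β : (quasiSplit (↥(maximalRealSubfield L)) L (IsCMField.complexConj L) 3).Adelic → ℝ≥0∞}
    (hβ : IsCoveringWeight ↥((arithmeticBorel (↥(maximalRealSubfield L)) L (IsCMField.complexConj L) 3).map (quasiSplit (↥(maximalRealSubfield L)) L (IsCMField.complexConj L) 3).arithmeticSubgroup.subtype) β)
    {μZ : Measure (borelQuotient (↥(maximalRealSubfield L)) L (IsCMField.complexConj L) 3)} [SFinite μZ]
    (hμZ : ∀ f : borelQuotient (↥(maximalRealSubfield L)) L (IsCMField.complexConj L) 3 → ℝ≥0∞, Measurable f → ∫⁻ z, f z ∂μZ = ∫⁻ g, β g * f (toBorelQuotient (↥(maximalRealSubfield L)) L (IsCMField.complexConj L) 3 g) ∂νG)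
    (n : ℕ) (hn : 0 < n)
    -- ── the ball's CONVOLUTION DATA as binders (★ `exists_convData_cm_three` ∕ ★ `exists_chi_convData_cm_three` clauses, verbatim) ──
    {I : Type} [Fintype I] (i₀ : I) (η : I → GL (Fin 3) (AdeleRing (𝓞 L) L) → ℝ) {a : ℝ≥0} (ha : 0 < a) (κ : I → ℝ≥0)
    (T : I → HX (↥(maximalRealSubfield L)) L (IsCMField.complexConj L) 3 (n + 4) μ →L[ℂ] HX (↥(maximalRealSubfield L)) L (IsCMField.complexConj L) 3 (n + 4) μ)
    -- the EIGENVALUE FUNCTIONS (★ convData_χ's `ŝ i`: entire, one non-constant member)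
    (ŝ : I → ℂ → ℂ) (hŝ : ∀ i, Differentiable ℂ (ŝ i)) (hnc : ∃ z₁ z₂ : ℂ, ŝ i₀ z₁ ≠ ŝ i₀ z₂)
    (hη : ∀ i, IsTestFunctionGL 3 L (η i))
    (hconv : ∀ i, Continuous ((fun (i : I) (y : (quasiSplit (↥(maximalRealSubfield L)) L (IsCMField.complexConj L) 3).Adelic) => orbitalSmoothing νG (fun x : (quasiSplit (↥(maximalRealSubfield L)) L (IsCMField.complexConj L) 3).Adelic => ((η i (adelicVal (↥(maximalRealSubfield L)) L (IsCMField.complexConj L) 3 ((StdForm.antidiagonal 3).over L) x) : ℝ) : ℂ)) (fun x : (quasiSplit (↥(maximalRealSubfield L)) L (IsCMField.complexConj L) 3).Adelic => ((η i (adelicVal (↥(maximalRealSubfield L)) L (IsCMField.complexConj L) 3 ((StdForm.antidiagonal 3).over L) x) : ℝ) : ℂ)) y) i) ∧ HasCompactSupport ((fun (i : I) (y : (quasiSplit (↥(maximalRealSubfield L)) L (IsCMField.complexConj L) 3).Adelic) => orbitalSmoothing νG (fun x : (quasiSplit (↥(maximalRealSubfield L)) L (IsCMField.complexConj L) 3).Adelic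 => ((η i (adelicVal (↥(maximalRealSubfield L)) L (IsCMField.complexConj L) 3 ((StdForm.antidiagonal 3).over L) x) : ℝ) : ℂ)) (fun x : (quasiSplit (↥(maximalRealSubfield L)) L (IsCMField.complexConj L) 3).Adelic => ((η i (adelicVal (↥(maximalRealSubfield L)) L (IsCMField.complexConj L) 3 ((StdForm.antidiagonal 3).over L) x) : ℝ) : ℂ)) y) i) ∧ (∀ g, (fun (i : I) (y : (quasiSplit (↥(maximalRealSubfield L)) L (IsCMField.complexConj L) 3).Adelic) => orbitalSmoothing νG (fun x : (quasiSplit (↥(maximalRealSubfield L)) L (IsCMField.complexConj L) 3).Adelic => ((η i (adelicVal (↥(maximalRealSubfield L)) L (IsCMField.complexConj L) 3 ((StdForm.antidiagonal 3).over L) x) : ℝ) : ℂ)) (fun x : (quasiSplit (↥(maximalRealSubfield L)) L (IsCMField.complexConj L) 3).Adelic => ((η i (adelicVal (↥(maximalRealSubfield L)) L (IsCMField.complexConj L) 3 ((StdForm.antidiagonal 3).over L) x) : ℝ) : ℂ)) y) i g⁻¹ = (fun (i : I) (y : (quasiSplit (↥(maximalRealSubfield L)) L (IsCMField.complexConj L)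 3).Adelic) => orbitalSmoothing νG (fun x : (quasiSplit (↥(maximalRealSubfield L)) L (IsCMField.complexConj L) 3).Adelic => ((η i (adelicVal (↥(maximalRealSubfield L)) L (IsCMField.complexConj L) 3 ((StdForm.antidiagonal 3).over L) x) : ℝ) : ℂ)) (fun x : (quasiSplit (↥(maximalRealSubfield L)) L (IsCMField.complexConj L) 3).Adelic => ((η i (adelicVal (↥(maximalRealSubfield L)) L (IsCMField.complexConj L) 3 ((StdForm.antidiagonal 3).over L) x) : ℝ) : ℂ)) y) i g) ∧ (∀ g, conj ((fun (i : I) (y : (quasiSplit (↥(maximalRealSubfield L)) L (IsCMField.complexConj L) 3).Adelic) => orbitalSmoothing νG (fun x : (quasiSplit (↥(maximalRealSubfield L)) L (IsCMField.complexConj L) 3).Adelic => ((η i (adelicVal (↥(maximalRealSubfield L)) L (IsCMField.complexConj L) 3 ((StdForm.antidiagonal 3).over L) x) : ℝ) : ℂ)) (fun x : (quasiSplit (↥(maximalRealSubfield L)) L (IsCMField.complexConj L) 3).Adelic => ((η i (adelicVal (↥(maximalRealSubfield L)) L (IsCMField.complexConj L) 3 ((StdForm.antidiagonal 3).over L) x)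 : ℝ) : ℂ)) y) i g) = (fun (i : I) (y : (quasiSplit (↥(maximalRealSubfield L)) L (IsCMField.complexConj L) 3).Adelic) => orbitalSmoothing νG (fun x : (quasiSplit (↥(maximalRealSubfield L)) L (IsCMField.complexConj L) 3).Adelic => ((η i (adelicVal (↥(maximalRealSubfield L)) L (IsCMField.complexConj L) 3 ((StdForm.antidiagonal 3).over L) x) : ℝ) : ℂ)) (fun x : (quasiSplit (↥(maximalRealSubfield L)) L (IsCMField.complexConj L) 3).Adelic => ((η i (adelicVal (↥(maximalRealSubfield L)) L (IsCMField.complexConj L) 3 ((StdForm.antidiagonal 3).over L) x) : ℝ) : ℂ)) y) i g) ∧ (∀ g, 0 ≤ ((fun (i : I) (y : (quasiSplit (↥(maximalRealSubfield L)) L (IsCMField.complexConj L) 3).Adelic) => orbitalSmoothing νG (fun x : (quasiSplit (↥(maximalRealSubfield L)) L (IsCMField.complexConj L) 3).Adelic => ((η i (adelicVal (↥(maximalRealSubfield L)) L (IsCMField.complexConj L) 3 ((StdForm.antidiagonal 3).over L) x) : ℝ) : ℂ)) (fun x : (quasiSplit (↥(maximalRealSubfield L)) L (IsCMField.complexConj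 L) 3).Adelic => ((η i (adelicVal (↥(maximalRealSubfield L)) L (IsCMField.complexConj L) 3 ((StdForm.antidiagonal 3).over L) x) : ℝ) : ℂ)) y) i g).re))
    (hcov : ∀ z ∈ Metric.ball (0 : ℂ) (n + 2), ∃ i, (ŝ i z) ≠ 0)
    (hκ : ∀ i, 1 ≤ κ i ∧ a ≤ κ i * a)
    (hcmp : ∀ i, ∀ z : borelQuotient (↥(maximalRealSubfield L)) L (IsCMField.complexConj L) 3, ∀ y ∈ tsupport ((fun (i : I) (y : (quasiSplit (↥(maximalRealSubfield L)) L (IsCMField.complexConj L) 3).Adelic) => orbitalSmoothing νG (fun x : (quasiSplit (↥(maximalRealSubfield L)) L (IsCMField.complexConj L) 3).Adelic => ((η i (adelicVal (↥(maximalRealSubfield L)) L (IsCMField.complexConj L) 3 ((StdForm.antidiagonal 3).over L) x) : ℝ) : ℂ)) (fun x : (quasiSplit (↥(maximalRealSubfield L)) L (IsCMField.complexConj L) 3).Adelic => ((η i (adelicVal (↥(maximalRealSubfield L)) L (IsCMField.complexConj L) 3 ((StdForm.antidiagonal 3).over L) x) : ℝ) : ℂ)) y) i),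
      borelQuotHeight (↥(maximalRealSubfield L)) L (IsCMField.complexConj L) 3 z ≤ κ i * borelQuotHeight (↥(maximalRealSubfield L)) L (IsCMField.complexConj L) 3 (rightShift (↥(maximalRealSubfield L)) L (IsCMField.complexConj L) 3 y z))
    (hι : ∀ i, ∃ hpos : 0 < κ i * a, Function.Injective (iota (iotaBound_cm_three L μ νG hβ hμZ hpos (n + 4))) ∧
      IsClosed ((LinearMap.range (iota (iotaBound_cm_three L μ νG hβ hμZ hpos (n + 4))).toLinearMap : Submodule ℂ (HN (↥(maximalRealSubfield L)) L (IsCMField.complexConj L) 3 (n + 4) (κ i * a) μZ)) : Set (HN (↥(maximalRealSubfield L)) L (IsCMField.complexConj L) 3 (n + 4) (κ i * a) μZ)))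
    (hT : ∀ i, ∀ u : HX (↥(maximalRealSubfield L)) L (IsCMField.complexConj L) 3 (n + 4) μ, ((T i u : HX (↥(maximalRealSubfield L)) L (IsCMField.complexConj L) 3 (n + 4) μ) : (quasiSplit (↥(maximalRealSubfield L)) L (IsCMField.complexConj L) 3).automorphicQuotient → ℂ) =ᵐ[(μ.withDensity fun x => (((supHeight (↥(maximalRealSubfield L)) L (IsCMField.complexConj L) 3 x)⁻¹ ^ (2 * (n + 4)) : ℝ≥0) : ℝ≥0∞))] fun ξ => ∫ y, (fun (i : I) (y : (quasiSplit (↥(maximalRealSubfield L)) L (IsCMField.complexConj L) 3).Adelic) => orbitalSmoothing νG (fun x : (quasiSplit (↥(maximalRealSubfield L)) L (IsCMField.complexConj L) 3).Adelic => ((η i (adelicVal (↥(maximalRealSubfield L)) L (IsCMField.complexConj L) 3 ((StdForm.antidiagonal 3).over L) x) : ℝ) : ℂ)) (fun x : (quasiSplit (↥(maximalRealSubfield L)) L (IsCMField.complexConj L) 3).Adelic => ((η i (adelicVal (↥(maximalRealSubfield L)) L (IsCMField.complexConj L) 3 ((StdForm.antidiagonal 3).over L) x) : ℝ) : ℂ))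 y) i y * (u : (quasiSplit (↥(maximalRealSubfield L)) L (IsCMField.complexConj L) 3).automorphicQuotient → ℂ) (y⁻¹ • ξ) ∂νG)
    (hpack : ∀ i, ∃ hs : ShiftBound (↥(maximalRealSubfield L)) L (IsCMField.complexConj L) 3 (n + 4) a (κ i * a) νG μZ ((fun (i : I) (y : (quasiSplit (↥(maximalRealSubfield L)) L (IsCMField.complexConj L) 3).Adelic) => orbitalSmoothing νG (fun x : (quasiSplit (↥(maximalRealSubfield L)) L (IsCMField.complexConj L) 3).Adelic => ((η i (adelicVal (↥(maximalRealSubfield L)) L (IsCMField.complexConj L) 3 ((StdForm.antidiagonal 3).over L) x) : ℝ) : ℂ)) (fun x : (quasiSplit (↥(maximalRealSubfield L)) L (IsCMField.complexConj L) 3).Adelic => ((η i (adelicVal (↥(maximalRealSubfield L)) L (IsCMField.complexConj L) 3 ((StdForm.antidiagonal 3).over L) x) : ℝ) : ℂ)) y) i),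
      ∀ h01 : a ≤ κ i * a, deltaShift hs ∘L iota (iotaBound_cm_three L μ νG hβ hμZ ha (n + 4)) = restrHN (↥(maximalRealSubfield L)) L (IsCMField.complexConj L) 3 (n + 4) h01 μZ ∘L iota (iotaBound_cm_three L μ νG hβ hμZ ha (n + 4)) ∘L T i)
    -- ── the section data (as ★ §2a) ──
    {χ₁ : HeckeCharacter L} {χ₂ : ↥(TorusDict.torus (IsCMField.complexConj L)) →ₜ* ℂˣ} (hχ₂ : TorusDict.IsAutomorphic (IsCMField.complexConj L) χ₂)
    {φ : (quasiSplit (↥(maximalRealSubfield L)) L (IsCMField.complexConj L) 3).Adelic → ℂ} (hφ : IsChiSectionPair χ₁ χ₂ φ) (hφc : Continuous φ) {Mφ : ℝ} (hφM : ∀ x, ‖φ x‖ ≤ Mφ)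
    {χ₁' : HeckeCharacter L} {χ₂' : ↥(TorusDict.torus (IsCMField.complexConj L)) →ₜ* ℂˣ} (hχ₂' : TorusDict.IsAutomorphic (IsCMField.complexConj L) χ₂')
    {ι' : Type} [Fintype ι'] {φ' : ι' → (quasiSplit (↥(maximalRealSubfield L)) L (IsCMField.complexConj L) 3).Adelic → ℂ} (hli : LinearIndependent ℂ φ') (hφ'c : ∀ j, Continuous (φ' j))
    (hφ'χ : ∀ j, IsChiSectionPair χ₁' χ₂' (φ' j)) {Mb : ℝ} (hφ'M : ∀ j x, ‖φ' j x‖ ≤ Mb)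
    (bX : ℂ → ι' → ℂ)
    (hbX : ∀ z ∈ Metric.ball (0 : ℂ) (n + 2), 2 < z.re → (∑ j, bX z j • φ' j) = ((((ν 𝓕).toReal⁻¹ : ℝ)) : ℂ) • (fun g : (quasiSplit (↥(maximalRealSubfield L)) L (IsCMField.complexConj L) 3).Adelic => (∫ v : ↥(adelicUnipotent (↥(maximalRealSubfield L)) L (IsCMField.complexConj L) 3), flatSectionU φ z ((quasiSplit (↥(maximalRealSubfield L)) L (IsCMField.complexConj L) 3).toAdelic (weylLongU ((IsCMField.complexConj L : L ≃ₐ[↥(maximalRealSubfield L)] L) : L →+* L) (rfl : (StdForm.antidiagonal 3).over L = (StdForm.antidiagonal 3).over L)) * ((v : (quasiSplit (↥(maximalRealSubfield L)) L (IsCMField.complexConj L) 3).Adelic) * g)) ∂ν) * (((borelHeight g : ℝ) : ℂ) ^ (z - 2))))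
    -- ── THE LETTER: the `h_i` act on the flat sections `f_z^φ` by the EIGENVALUES `ŝ_i(z)` (★ convData_χ ∕ ★ `exists_chi_convData_level_cm_three`) ──
    (hS1 : ∀ i (z : ℂ), 2 < z.re → ∀ x : (quasiSplit (↥(maximalRealSubfield L)) L (IsCMField.complexConj L) 3).Adelic, (∫ y, (fun (i : I) (y : (quasiSplit (↥(maximalRealSubfield L)) L (IsCMField.complexConj L) 3).Adelic) => orbitalSmoothing νG (fun x : (quasiSplit (↥(maximalRealSubfield L)) L (IsCMField.complexConj L) 3).Adelic => ((η i (adelicVal (↥(maximalRealSubfield L)) L (IsCMField.complexConj L) 3 ((StdForm.antidiagonal 3).over L) x) : ℝ) : ℂ)) (fun x : (quasiSplit (↥(maximalRealSubfield L)) L (IsCMField.complexConj L) 3).Adelic => ((η i (adelicVal (↥(maximalRealSubfield L)) L (IsCMField.complexConj L) 3 ((StdForm.antidiagonal 3).over L) x) : ℝ) : ℂ)) y) i y * flatSectionU φ z (x * y) ∂νG) = (ŝ i z) * flatSectionU φ z x) :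
    ∃ (U : Set ℂ) (vX : ℂ → HX (↥(maximalRealSubfield L)) L (IsCMField.complexConj L) 3 (n + 4) μ) (cc : ℂ → ι' → ℂ) (hb : IotaBound (↥(maximalRealSubfield L)) L (IsCMField.complexConj L) 3 (n + 4) a μ μZ) (α₁ : ℂ → HN (↥(maximalRealSubfield L)) L (IsCMField.complexConj L) 3 (n + 4) a μZ) (col : ι' → ℂ → HN (↥(maximalRealSubfield L)) L (IsCMField.complexConj L) 3 (n + 4) a μZ),
      IsOpen U ∧ U ⊆ Metric.ball (0 : ℂ) (n + 2) ∧ Metric.ball (0 : ℂ) (n + 2) ⊆ closure U ∧ (∀ z₀ ∈ Metric.ball (0 : ℂ) (n + 2), ∀ᶠ s in 𝓝[≠] z₀, s ∈ U) ∧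
      DifferentiableOn ℂ vX U ∧ MeromorphicOn vX (Metric.ball (0 : ℂ) (n + 2)) ∧ DifferentiableOn ℂ cc U ∧ MeromorphicOn cc (Metric.ball (0 : ℂ) (n + 2)) ∧
      (∀ z ∈ Metric.ball (0 : ℂ) (n + 2), (α₁ z : borelQuotient (↥(maximalRealSubfield L)) L (IsCMField.complexConj L) 3 → ℂ) =ᵐ[weightedTruncMeasure (↥(maximalRealSubfield L)) L (IsCMField.complexConj L) 3 (n + 4) a μZ] zFun (↥(maximalRealSubfield L)) L (IsCMField.complexConj L) 3 (flatSectionU φ z)) ∧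
      (∀ j, ∀ z ∈ Metric.ball (0 : ℂ) (n + 2), (col j z : borelQuotient (↥(maximalRealSubfield L)) L (IsCMField.complexConj L) 3 → ℂ) =ᵐ[weightedTruncMeasure (↥(maximalRealSubfield L)) L (IsCMField.complexConj L) 3 (n + 4) a μZ] zFun (↥(maximalRealSubfield L)) L (IsCMField.complexConj L) 3 (flatSectionU (φ' j) (2 - z))) ∧
      (∀ z ∈ U, (∀ i, T i (vX z) = (ŝ i z) • vX z) ∧ cnstN (↥(maximalRealSubfield L)) L (IsCMField.complexConj L) 3 (n + 4) a μZ (iota hb (vX z)) = (1 : ℂ) • α₁ z + (∑ j, (ContinuousLinearMap.proj (R := ℂ) (φ := fun _ : ι' => ℂ) j).smulRight (col j z) : (ι' → ℂ) →L[ℂ] HN (↥(maximalRealSubfield L)) L (IsCMField.complexConj L) 3 (n + 4) a μZ) (cc z)) ∧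
      (∀ z ∈ U, ∀ (ψ : HX (↥(maximalRealSubfield L)) L (IsCMField.complexConj L) 3 (n + 4) μ) (b : ι' → ℂ), (∀ i, T i ψ = (ŝ i z) • ψ) →
        cnstN (↥(maximalRealSubfield L)) L (IsCMField.complexConj L) 3 (n + 4) a μZ (iota hb ψ) = (1 : ℂ) • α₁ z + (∑ j, (ContinuousLinearMap.proj (R := ℂ) (φ := fun _ : ι' => ℂ) j).smulRight (col j z) : (ι' → ℂ) →L[ℂ] HN (↥(maximalRealSubfield L)) L (IsCMField.complexConj L) 3 (n + 4) a μZ) b → ψ = vX z ∧ b = cc z) ∧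
      (∀ z ∈ U, 2 < z.re → ((vX z : HX (↥(maximalRealSubfield L)) L (IsCMField.complexConj L) 3 (n + 4) μ) : (quasiSplit (↥(maximalRealSubfield L)) L (IsCMField.complexConj L) 3).automorphicQuotient → ℂ) =ᵐ[(μ.withDensity fun x => (((supHeight (↥(maximalRealSubfield L)) L (IsCMField.complexConj L) 3 x)⁻¹ ^ (2 * (n + 4)) : ℝ≥0) : ℝ≥0∞))] (quasiSplit (↥(maximalRealSubfield L)) L (IsCMField.complexConj L) 3).quotFun (eisensteinSeriesU (flatSectionU φ z)) ∧ cc z = bX z) ∧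
      ∀ g : (quasiSplit (↥(maximalRealSubfield L)) L (IsCMField.complexConj L) 3).Adelic, ∃ Ec : ℂ → ℂ, MeromorphicOn Ec (Metric.ball (0 : ℂ) (n + 2)) ∧ (∀ z ∈ Metric.ball (0 : ℂ) (n + 2), 2 < z.re → Ec z = eisensteinSeriesU (flatSectionU φ z) g) ∧ (∀ z ∈ U, 0 ≤ meromorphicOrderAt Ec z) ∧
        ∀ j, ∀ z ∈ U, (ŝ j z) ≠ 0 →
          Ec =ᶠ[𝓝[≠] z] fun s => (ŝ j s)⁻¹ * ∫ y, (fun (i : I) (y : (quasiSplit (↥(maximalRealSubfield L)) L (IsCMField.complexConj L) 3).Adelic) => orbitalSmoothing νG (fun x : (quasiSplit (↥(maximalRealSubfield L)) L (IsCMField.complexConj L) 3).Adelic => ((η i (adelicVal (↥(maximalRealSubfield L)) L (IsCMField.complexConj L) 3 ((StdForm.antidiagonal 3).over L) x) : ℝ) : ℂ)) (fun x : (quasiSplit (↥(maximalRealSubfield L)) L (IsCMField.complexConj L) 3).Adelic => ((η i (adelicVal (↥(maximalRealSubfield L)) L (IsCMField.complexConj L) 3 ((StdForm.antidiagonal 3).over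 L) x) : ℝ) : ℂ)) y) j y * ((vX s : HX (↥(maximalRealSubfield L)) L (IsCMField.complexConj L) 3 (n + 4) μ) : (quasiSplit (↥(maximalRealSubfield L)) L (IsCMField.complexConj L) 3).automorphicQuotient → ℂ) ((quasiSplit (↥(maximalRealSubfield L)) L (IsCMField.complexConj L) 3).toAutomorphicQuotient (g * y)⁻¹) ∂νG := by
  -- involution facts and a non-zero trace-zero element of `L` (★ X1)
  have hc : IsCMField.complexConj L * IsCMField.complexConj L = 1 := AlgEquiv.ext fun x => by rw [AlgEquiv.mul_apply, AlgEquiv.one_apply, IsCMField.complexConj_apply_apply]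
  have hc1 : IsCMField.complexConj L ≠ 1 := IsCMField.complexConj_ne_one L
  haveI : νG.IsMulRightInvariant := by rw [← Measure.inv_eq_self νG]; infer_instance
  have hright := measurePreserving_rightShift_of_unfolding νG hβ hμZ
  -- the convolution data unpacked
  choose hpos hinj hcl using hι
  choose hs hδι using hpack
  have hfin : μZ {z | a < borelQuotHeight (↥(maximalRealSubfield L)) L (IsCMField.complexConj L) 3 z} ≠ ∞ := measure_setOf_lt_ne_top_cm_three L μ νG hβ hμZ ha
  haveI : IsFiniteMeasure (weightedTruncMeasure (↥(maximalRealSubfield L)) L (IsCMField.complexConj L) 3 (n + 4) a μZ) := isFiniteMeasure_weightedTruncMeasure_cm_three L μ νG hβ hμZ ha (n + 4)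
  have hfin₀ : ∀ i, IsFiniteMeasure (weightedTruncMeasure (↥(maximalRealSubfield L)) L (IsCMField.complexConj L) 3 (n + 4) (κ i * a) μZ) := fun i => isFiniteMeasure_weightedTruncMeasure_cm_three L μ νG hβ hμZ (hpos i) (n + 4)
  -- K2's letter at the system levels `(a, κ_i a)` (★ `hK1_cm_three_of`, `m = 0`), verbatim ★ X1
  letI : MeasurableSpace (AdeleRing (𝓞 L) L) := borel _
  haveI : BorelSpace (AdeleRing (𝓞 L) L) := ⟨rfl⟩
  have hK1i : ∀ i, ∃ m C : ℝ, 0 ≤ m ∧ 0 ≤ C ∧ ∀ f : HNcusp (↥(maximalRealSubfield L)) L (IsCMField.complexConj L) 3 (n + 4) a μZ, ∀ᵐ z ∂(weightedTruncMeasure (↥(maximalRealSubfield L)) L (IsCMField.complexConj L) 3 (n + 4) (κ i * a) μZ),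
      ‖rightConvFun (↥(maximalRealSubfield L)) L (IsCMField.complexConj L) 3 νG ((fun (i : I) (y : (quasiSplit (↥(maximalRealSubfield L)) L (IsCMField.complexConj L) 3).Adelic) => orbitalSmoothing νG (fun x : (quasiSplit (↥(maximalRealSubfield L)) L (IsCMField.complexConj L) 3).Adelic => ((η i (adelicVal (↥(maximalRealSubfield L)) L (IsCMField.complexConj L) 3 ((StdForm.antidiagonal 3).over L) x) : ℝ) : ℂ)) (fun x : (quasiSplit (↥(maximalRealSubfield L)) L (IsCMField.complexConj L) 3).Adelic => ((η i (adelicVal (↥(maximalRealSubfield L)) L (IsCMField.complexConj L) 3 ((StdForm.antidiagonal 3).over L) x) : ℝ) : ℂ)) y) i) ((f : HN (↥(maximalRealSubfield L)) L (IsCMField.complexConj L) 3 (n + 4) a μZ) : borelQuotient (↥(maximalRealSubfield L)) L (IsCMField.complexConj L) 3 → ℂ) z‖ ≤ C * ‖f‖ * ((borelQuotHeight (↥(maximalRealSubfield L)) L (IsCMField.complexConj L) 3 z : ℝ)) ^ (-m) := fun i => by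
    obtain ⟨C₀, hC₀, hh⟩ := K2E1TruncatedCuspDecayHK1CMThree.hK1_cm_three_of L μZ νG hβ hμZ (hη i) (n + 4) a (κ i * a) (hpos i)
      (fun νN _ _ _ 𝓕N h𝓕 h0 htop f => K2E1TruncatedCuspConstantTermAEU2.ae_borelConstantTerm_indicator_comp_eq_zero_of_mem_HNcusp νG νN
        (fun _ hb₀ => map_conj_toAdelic_eq_self_three hc hc1 νN hb₀) h𝓕 h0 htop hβ hμZ (n + 4) a f)
      (lt_of_lt_of_le zero_lt_one (hκ i).1) le_rfl (hcmp i) (m := 0) le_rfl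
    exact ⟨0, C₀, le_rfl, hC₀, hh⟩
  choose m C hm hC hK1' using hK1i
  -- the constant-term data (★ §2a)
  obtain ⟨hb, α₁, col, eX, hα₁ae, hα₁d, hcolae, -, hLd, hLinj, heXae, hsolC⟩ :=
    exists_chiPair_constantTerm_data_cm_three L μ νG ν h𝓕N h𝓕c h𝓕₀ hβ hμZ n ha hχ₂ hφ hφc hφM hχ₂' hli hφ'c hφ'χ hφ'M bX hbX
  -- `L z b = Σ_j b_j • col j z`
  have hLapp : ∀ z (b : ι' → ℂ), (∑ j, (ContinuousLinearMap.proj (R := ℂ) (φ := fun _ : ι' => ℂ) j).smulRight (col j z) : (ι' → ℂ) →L[ℂ] HN (↥(maximalRealSubfield L)) L (IsCMField.complexConj L) 3 (n + 4) a μZ) b = ∑ j, b j • col j z := fun z b => by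
    simp only [FunLike.coe_sum, Finset.sum_apply, ContinuousLinearMap.smulRight_apply, ContinuousLinearMap.proj_apply]
  -- (S1)χ: the eigen-equations `T_i (eX z) = ĥ_i(z) • eX z` from the letter `hS1` (★ row 10, the letter `hS1`, `E(c•f) = c•E(f)`, a.e. transport)
  have hH : ∀ x : (quasiSplit (↥(maximalRealSubfield L)) L (IsCMField.complexConj L) 3).Adelic, (((borelHeight x : ℝ≥0) : ℝ) : ℂ) ≠ 0 := fun x => Complex.ofReal_ne_zero.2 (NNReal.coe_pos.2 (borelHeight_pos x)).ne'
  have hev : ∀ z : ℂ, 2 < z.re → ∀ i (g₀ : (quasiSplit (↥(maximalRealSubfield L)) L (IsCMField.complexConj L) 3).Adelic), (∫ y, (fun (i : I) (y : (quasiSplit (↥(maximalRealSubfield L)) L (IsCMField.complexConj L) 3).Adelic) => orbitalSmoothing νG (fun x : (quasiSplit (↥(maximalRealSubfield L)) L (IsCMField.complexConj L) 3).Adelic => ((η i (adelicVal (↥(maximalRealSubfield L)) L (IsCMField.complexConj L) 3 ((StdForm.antidiagonal 3).over L) x) : ℝ) : ℂ)) (fun x : (quasiSplit (↥(maximalRealSubfield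 L)) L (IsCMField.complexConj L) 3).Adelic => ((η i (adelicVal (↥(maximalRealSubfield L)) L (IsCMField.complexConj L) 3 ((StdForm.antidiagonal 3).over L) x) : ℝ) : ℂ)) y) i y * eisensteinSeriesU (flatSectionU φ z) (g₀ * y) ∂νG) = (ŝ i z) * eisensteinSeriesU (flatSectionU φ z) g₀ := by
    intro z hz1 i g₀
    rw [integral_mul_eisensteinSeriesU_flatSectionU_eq_cm_three L νG (hconv i).1 (hconv i).2.1 hφc hφM hz1 g₀]
    have hinner : flatSectionU (fun x : (quasiSplit (↥(maximalRealSubfield L)) L (IsCMField.complexConj L) 3).Adelic => (∫ y, (fun (i : I) (y : (quasiSplit (↥(maximalRealSubfield L)) L (IsCMField.complexConj L) 3).Adelic) => orbitalSmoothing νG (fun x : (quasiSplit (↥(maximalRealSubfield L)) L (IsCMField.complexConj L) 3).Adelic => ((η i (adelicVal (↥(maximalRealSubfield L)) L (IsCMField.complexConj L) 3 ((StdForm.antidiagonal 3).over L) x) : ℝ) : ℂ)) (fun x : (quasiSplit (↥(maximalRealSubfield L)) L (IsCMField.complexConj L) 3).Adelic => ((η i (adelicVal (↥(maximalRealSubfield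 L)) L (IsCMField.complexConj L) 3 ((StdForm.antidiagonal 3).over L) x) : ℝ) : ℂ)) y) i y * flatSectionU φ z (x * y) ∂νG) * (((borelHeight x : ℝ≥0) : ℝ) : ℂ) ^ (-z)) z =
        (ŝ i z) • flatSectionU φ z := by
      funext g
      rw [flatSectionU_apply, hS1 i z hz1 g, Pi.smul_apply, smul_eq_mul, mul_assoc, mul_assoc, ← Complex.cpow_add _ _ (hH g), neg_add_cancel, Complex.cpow_zero, mul_one]
    rw [hinner, eisensteinSeriesU_smul]
  have hsolT : ∀ z ∈ Metric.ball (0 : ℂ) (n + 2), (2 : ℝ) < z.re → ∀ i, T i (eX z) = (ŝ i z) • eX z := by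
    intro z hz hz1 i
    have hψ := (heXae z hz hz1)
    have hφG := eisensteinSeriesU_flatSectionU_quotientSubgroup_mul_of_borelU_invariant L (hφ.toAdelic_mul hχ₂) z
    have hevq : ∀ ξ : (quasiSplit (↥(maximalRealSubfield L)) L (IsCMField.complexConj L) 3).automorphicQuotient, (∫ y, (fun (i : I) (y : (quasiSplit (↥(maximalRealSubfield L)) L (IsCMField.complexConj L) 3).Adelic) => orbitalSmoothing νG (fun x : (quasiSplit (↥(maximalRealSubfield L)) L (IsCMField.complexConj L) 3).Adelic => ((η i (adelicVal (↥(maximalRealSubfield L)) L (IsCMField.complexConj L) 3 ((StdForm.antidiagonal 3).over L) x) : ℝ) : ℂ)) (fun x : (quasiSplit (↥(maximalRealSubfield L)) L (IsCMField.complexConj L) 3).Adelic => ((η i (adelicVal (↥(maximalRealSubfield L)) L (IsCMField.complexConj L) 3 ((StdForm.antidiagonal 3).over L) x) : ℝ) : ℂ)) y) i y * (quasiSplit (↥(maximalRealSubfield L)) L (IsCMField.complexConj L) 3).quotFun (eisensteinSeriesU (flatSectionU φ z)) (y⁻¹ • ξ) ∂νG) =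
        (ŝ i z) * (quasiSplit (↥(maximalRealSubfield L)) L (IsCMField.complexConj L) 3).quotFun (eisensteinSeriesU (flatSectionU φ z)) ξ := by
      intro ξ
      obtain ⟨g₀, rfl⟩ := QuotientGroup.mk_surjective ξ
      change (∫ y, (fun (i : I) (y : (quasiSplit (↥(maximalRealSubfield L)) L (IsCMField.complexConj L) 3).Adelic) => orbitalSmoothing νG (fun x : (quasiSplit (↥(maximalRealSubfield L)) L (IsCMField.complexConj L) 3).Adelic => ((η i (adelicVal (↥(maximalRealSubfield L)) L (IsCMField.complexConj L) 3 ((StdForm.antidiagonal 3).over L) x) : ℝ) : ℂ)) (fun x : (quasiSplit (↥(maximalRealSubfield L)) L (IsCMField.complexConj L) 3).Adelic => ((η i (adelicVal (↥(maximalRealSubfield L)) L (IsCMField.complexConj L) 3 ((StdForm.antidiagonal 3).over L) x) : ℝ) : ℂ)) y) i y * (quasiSplit (↥(maximalRealSubfield L)) L (IsCMField.complexConj L) 3).quotFun (eisensteinSeriesU (flatSectionU φ z)) (y⁻¹ • (quasiSplit (↥(maximalRealSubfield L)) L (IsCMField.complexConj L) 3).toAutomorphicQuotient g₀) ∂νG)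 =
        (ŝ i z) * (quasiSplit (↥(maximalRealSubfield L)) L (IsCMField.complexConj L) 3).quotFun (eisensteinSeriesU (flatSectionU φ z)) ((quasiSplit (↥(maximalRealSubfield L)) L (IsCMField.complexConj L) 3).toAutomorphicQuotient g₀)
      simp only [quotFun_inv_smul_toAutomorphicQuotient_three L hφG, AdelicGroupData.quotFun_toAutomorphicQuotient hφG]
      simpa only using hev z hz1 i g₀⁻¹
    have h2 := convX_congr_ae νG μ ((fun (i : I) (y : (quasiSplit (↥(maximalRealSubfield L)) L (IsCMField.complexConj L) 3).Adelic) => orbitalSmoothing νG (fun x : (quasiSplit (↥(maximalRealSubfield L)) L (IsCMField.complexConj L) 3).Adelic => ((η i (adelicVal (↥(maximalRealSubfield L)) L (IsCMField.complexConj L) 3 ((StdForm.antidiagonal 3).over L) x) : ℝ) : ℂ)) (fun x : (quasiSplit (↥(maximalRealSubfield L)) L (IsCMField.complexConj L) 3).Adelic => ((η i (adelicVal (↥(maximalRealSubfield L)) L (IsCMField.complexConj L) 3 ((StdForm.antidiagonal 3).over L) x) : ℝ) : ℂ)) y) i) ((ae_withDensity_weightX_iff μ (n + 4)).1 hψ)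
    refine Lp.ext ((hT i _).trans (EventuallyEq.trans ?_ (Lp.coeFn_smul _ _).symm))
    refine (ae_withDensity_weightX_iff μ (n + 4)).2 ?_
    filter_upwards [h2, (ae_withDensity_weightX_iff μ (n + 4)).1 hψ] with ξ hξ hψξ
    rw [hξ, hevq ξ, Pi.smul_apply, smul_eq_mul, hψξ]
  have hsolQ : ∀ z ∈ Metric.ball (0 : ℂ) (n + 2), (2 : ℝ) < z.re → (0 : HX (↥(maximalRealSubfield L)) L (IsCMField.complexConj L) 3 (n + 4) μ →L[ℂ] HX (↥(maximalRealSubfield L)) L (IsCMField.complexConj L) 3 (n + 4) μ) (eX z) = 0 := fun _ _ _ => rfl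
  have hsolC' : ∀ z ∈ Metric.ball (0 : ℂ) (n + 2), (2 : ℝ) < z.re → cnstN (↥(maximalRealSubfield L)) L (IsCMField.complexConj L) 3 (n + 4) a μZ (iota hb (eX z)) = (1 : ℂ) • α₁ z + (fun w => (∑ j, (ContinuousLinearMap.proj (R := ℂ) (φ := fun _ : ι' => ℂ) j).smulRight (col j w) : (ι' → ℂ) →L[ℂ] HN (↥(maximalRealSubfield L)) L (IsCMField.complexConj L) 3 (n + 4) a μZ)) z (bX z) :=
    fun z hz hz1 => hsolC z hz hz1
  have hLinj' : ∀ z ∈ Metric.ball (0 : ℂ) (n + 2), (2 : ℝ) < z.re → Function.Injective ((fun w => (∑ j, (ContinuousLinearMap.proj (R := ℂ) (φ := fun _ : ι' => ℂ) j).smulRight (col j w) : (ι' → ℂ) →L[ℂ] HN (↥(maximalRealSubfield L)) L (IsCMField.complexConj L) 3 (n + 4) a μZ)) z) := fun z hz hz1 => hLinj z hz hz1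
  -- `hδL`: `δ(L z b)` essentially bounded at the level `κ i₀ * a` (columns a.e. `zFun φ′_j · HZ^(1−z)`, ★ payer, finite sums)
  have hδL : ∀ z ∈ Metric.ball (0 : ℂ) (n + 2), 2 < z.re → ∀ b' : ι' → ℂ, ∃ M : ℝ, ∀ᵐ x ∂(weightedTruncMeasure (↥(maximalRealSubfield L)) L (IsCMField.complexConj L) 3 (n + 4) (κ i₀ * a) μZ),
      ‖(deltaShift (hs i₀) ((fun w => (∑ j, (ContinuousLinearMap.proj (R := ℂ) (φ := fun _ : ι' => ℂ) j).smulRight (col j w) : (ι' → ℂ) →L[ℂ] HN (↥(maximalRealSubfield L)) L (IsCMField.complexConj L) 3 (n + 4) a μZ)) z b') : borelQuotient (↥(maximalRealSubfield L)) L (IsCMField.complexConj L) 3 → ℂ) x‖ ≤ M := by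
    intro z hz hz1 b'
    have hcolj : ∀ j, ∃ Mj : ℝ, ∀ᵐ x ∂(weightedTruncMeasure (↥(maximalRealSubfield L)) L (IsCMField.complexConj L) 3 (n + 4) (κ i₀ * a) μZ), ‖(deltaShift (hs i₀) (col j z) : borelQuotient (↥(maximalRealSubfield L)) L (IsCMField.complexConj L) 3 → ℂ) x‖ ≤ Mj := fun j =>
      exists_ae_norm_deltaShift_le_of_ae_eq_mul_cpow hright (isClosed_tsupport _).measurableSet (lt_of_lt_of_le zero_lt_one (hκ i₀).1) le_rfl (hcmp i₀)
        (fun y hy => image_eq_zero_of_notMem_tsupport hy) ((hconv i₀).1.integrable_of_hasCompactSupport (hconv i₀).2.1) (hs i₀) ha (norm_zFun_le (hφ'M j))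
        (by rw [← zFun_flatSectionU]; exact hcolae j z hz) (by rw [Complex.sub_re, Complex.re_ofNat]; linarith)
    choose Mj hMj using hcolj
    refine ⟨∑ j, ‖b' j‖ * Mj j, ?_⟩
    have hsum : deltaShift (hs i₀) ((fun w => (∑ j, (ContinuousLinearMap.proj (R := ℂ) (φ := fun _ : ι' => ℂ) j).smulRight (col j w) : (ι' → ℂ) →L[ℂ] HN (↥(maximalRealSubfield L)) L (IsCMField.complexConj L) 3 (n + 4) a μZ)) z b') = ∑ j, b' j • deltaShift (hs i₀) (col j z) := by
      rw [show (fun w => (∑ j, (ContinuousLinearMap.proj (R := ℂ) (φ := fun _ : ι' => ℂ) j).smulRight (col j w) : (ι' → ℂ) →L[ℂ] HN (↥(maximalRealSubfield L)) L (IsCMField.complexConj L) 3 (n + 4) a μZ)) z b' = ∑ j, b' j • col j z from hLapp z b', _root_.map_sum]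
      simp only [map_smul]
    rw [hsum]
    filter_upwards [coeFn_sum_smul_ae_eq Finset.univ b' (fun j => deltaShift (hs i₀) (col j z)), ae_all_iff.2 hMj] with x hx hbd
    rw [hx]
    exact (norm_sum_le _ _).trans (Finset.sum_le_sum fun j _ => by rw [norm_mul]; exact mul_le_mul_of_nonneg_left (hbd j) (norm_nonneg _))
  -- uniqueness on an open non-empty part of the Godement set (★ `hunq_chi_cm_three`, `Q := 0`)
  have hunq := hunq_chi_cm_three_of_eigen L μ νG hβ hμZ (n + 4) n hn i₀ (h := (fun (i : I) (y : (quasiSplit (↥(maximalRealSubfield L)) L (IsCMField.complexConj L) 3).Adelic) => orbitalSmoothing νG (fun x : (quasiSplit (↥(maximalRealSubfield L)) L (IsCMField.complexConj L) 3).Adelic => ((η i (adelicVal (↥(maximalRealSubfield L)) L (IsCMField.complexConj L) 3 ((StdForm.antidiagonal 3).over L) x) : ℝ) : ℂ)) (fun x : (quasiSplit (↥(maximalRealSubfield L)) L (IsCMField.complexConj L) 3).Adelic => ((η i (adelicVal (↥(maximalRealSubfield L)) L (IsCMField.complexConj L) 3 ((StdForm.antidiagonal 3).over L) x) : ℝ)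 : ℂ)) y)) (fun i => (hconv i).1) (fun i => (hconv i).2.1) (hconv i₀).2.2.1 (hconv i₀).2.2.2.1 ŝ (hŝ i₀) hnc
    (hpos i₀) (hκ i₀).2 hfin hb (hs i₀) T (hT i₀) (hδι i₀ (hκ i₀).2) (hC i₀) (hm i₀) (hK1' i₀) α₁ (fun w => (∑ j, (ContinuousLinearMap.proj (R := ℂ) (φ := fun _ : ι' => ℂ) j).smulRight (col j w) : (ι' → ℂ) →L[ℂ] HN (↥(maximalRealSubfield L)) L (IsCMField.complexConj L) 3 (n + 4) a μZ)) hδL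
    (0 : HX (↥(maximalRealSubfield L)) L (IsCMField.complexConj L) 3 (n + 4) μ →L[ℂ] HX (↥(maximalRealSubfield L)) L (IsCMField.complexConj L) 3 (n + 4) μ) 1 eX bX hsolT hsolC' hsolQ
  -- the by-products of the 𝔛-system on the ball (★ X1_χ ED. 2, `σ₀ = 1`)
  obtain ⟨U, vX, cc, hUo, hUD, hDcl, hUcd, hvXd, hvXm, hccd, hccm, heqs, hunqU, hagree, hrepr⟩ :=
    exists_chi_xSystem_byproducts_of_eigen 2 n (n + 4) νG ha (a₀ := fun i => κ i * a) (fun i => (hκ i).2) (hfin₀ := hfin₀) hb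
      (fun i => iotaBound_cm_three L μ νG hβ hμZ (hpos i) (n + 4)) hcl hinj (fun (i : I) (y : (quasiSplit (↥(maximalRealSubfield L)) L (IsCMField.complexConj L) 3).Adelic) => orbitalSmoothing νG (fun x : (quasiSplit (↥(maximalRealSubfield L)) L (IsCMField.complexConj L) 3).Adelic => ((η i (adelicVal (↥(maximalRealSubfield L)) L (IsCMField.complexConj L) 3 ((StdForm.antidiagonal 3).over L) x) : ℝ) : ℂ)) (fun x : (quasiSplit (↥(maximalRealSubfield L)) L (IsCMField.complexConj L) 3).Adelic => ((η i (adelicVal (↥(maximalRealSubfield L)) L (IsCMField.complexConj L) 3 ((StdForm.antidiagonal 3).over L) x) : ℝ) : ℂ)) y) ŝ hŝ hcov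
      hs hm hC hK1' T (fun i => hδι i (hκ i).2) hα₁d (L := fun w => (∑ j, (ContinuousLinearMap.proj (R := ℂ) (φ := fun _ : ι' => ℂ) j).smulRight (col j w) : (ι' → ℂ) →L[ℂ] HN (↥(maximalRealSubfield L)) L (IsCMField.complexConj L) 3 (n + 4) a μZ)) hLd hLinj' (0 : HX (↥(maximalRealSubfield L)) L (IsCMField.complexConj L) 3 (n + 4) μ →L[ℂ] HX (↥(maximalRealSubfield L)) L (IsCMField.complexConj L) 3 (n + 4) μ) 1 eX bX hsolT hsolC' hsolQ hunq
  refine ⟨U, vX, cc, hb, α₁, col, hUo, hUD, hDcl, hUcd, hvXd, hvXm, hccd, hccm, hα₁ae, hcolae, fun z hz => ⟨(heqs z hz).1, (heqs z hz).2.1⟩,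
    fun z hz ψ b hψ hC' => hunqU z hz ψ b hψ hC' rfl, fun z hz hz1 => ⟨?_, (hagree z hz hz1).2⟩, fun g => ?_⟩
  · rw [(hagree z hz hz1).1]
    exact heXae z (hUD hz) hz1
  · -- (R4): the evaluation functionals (★ P3-D on the real functions `Re h_i = h_i`), `Λ_i [E(f_z^φ)] = ĥ_i(z)·E(f_z^φ)(g)`, ★ `hrepr`, and the integral form of `Λ_j (v_X s)`
    have hre : ∀ i x, (((((fun (i : I) (y : (quasiSplit (↥(maximalRealSubfield L)) L (IsCMField.complexConj L) 3).Adelic) => orbitalSmoothing νG (fun x : (quasiSplit (↥(maximalRealSubfield L)) L (IsCMField.complexConj L) 3).Adelic => ((η i (adelicVal (↥(maximalRealSubfield L)) L (IsCMField.complexConj L) 3 ((StdForm.antidiagonal 3).over L) x) : ℝ) : ℂ)) (fun x : (quasiSplit (↥(maximalRealSubfield L)) L (IsCMField.complexConj L) 3).Adelic => ((η i (adelicVal (↥(maximalRealSubfield L)) L (IsCMField.complexConj L) 3 ((StdForm.antidiagonal 3).over L) x) : ℝ) : ℂ)) y) i x).re : ℝ)) : ℂ) = (fun (i : I) (y : (quasiSplit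 (↥(maximalRealSubfield L)) L (IsCMField.complexConj L) 3).Adelic) => orbitalSmoothing νG (fun x : (quasiSplit (↥(maximalRealSubfield L)) L (IsCMField.complexConj L) 3).Adelic => ((η i (adelicVal (↥(maximalRealSubfield L)) L (IsCMField.complexConj L) 3 ((StdForm.antidiagonal 3).over L) x) : ℝ) : ℂ)) (fun x : (quasiSplit (↥(maximalRealSubfield L)) L (IsCMField.complexConj L) 3).Adelic => ((η i (adelicVal (↥(maximalRealSubfield L)) L (IsCMField.complexConj L) 3 ((StdForm.antidiagonal 3).over L) x) : ℝ) : ℂ)) y) i x := fun i x => Complex.conj_eq_iff_re.1 ((hconv i).2.2.2.1 x)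
    have hΛex : ∀ i, ∃ Λ : HX (↥(maximalRealSubfield L)) L (IsCMField.complexConj L) 3 (n + 4) μ →L[ℂ] ℂ, ∀ (u : (quasiSplit (↥(maximalRealSubfield L)) L (IsCMField.complexConj L) 3).Adelic → ℂ) (huG : ∀ γ ∈ (quasiSplit (↥(maximalRealSubfield L)) L (IsCMField.complexConj L) 3).quotientSubgroup, ∀ y, u (γ * y) = u y) (hu : MemLp ((quasiSplit (↥(maximalRealSubfield L)) L (IsCMField.complexConj L) 3).quotFun u) 2 (μ.withDensity fun x => (((supHeight (↥(maximalRealSubfield L)) L (IsCMField.complexConj L) 3 x)⁻¹ ^ (2 * (n + 4)) : ℝ≥0) : ℝ≥0∞))),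
        Integrable (fun y => (((((fun (i : I) (y : (quasiSplit (↥(maximalRealSubfield L)) L (IsCMField.complexConj L) 3).Adelic) => orbitalSmoothing νG (fun x : (quasiSplit (↥(maximalRealSubfield L)) L (IsCMField.complexConj L) 3).Adelic => ((η i (adelicVal (↥(maximalRealSubfield L)) L (IsCMField.complexConj L) 3 ((StdForm.antidiagonal 3).over L) x) : ℝ) : ℂ)) (fun x : (quasiSplit (↥(maximalRealSubfield L)) L (IsCMField.complexConj L) 3).Adelic => ((η i (adelicVal (↥(maximalRealSubfield L)) L (IsCMField.complexConj L) 3 ((StdForm.antidiagonal 3).over L) x) : ℝ) : ℂ)) y) i y).re : ℝ)) : ℂ) * u (g * y)) νG ∧ Λ (toHX (↥(maximalRealSubfield L)) L (IsCMField.complexConj L) 3 (n + 4) μ u hu) = ∫ y, (((((fun (i : I) (y : (quasiSplit (↥(maximalRealSubfield L)) L (IsCMField.complexConj L) 3).Adelic) => orbitalSmoothing νG (fun x : (quasiSplit (↥(maximalRealSubfield L)) L (IsCMField.complexConj L) 3).Adelic => ((η i (adelicVal (↥(maximalRealSubfield L)) L (IsCMField.complexConj L) 3 ((StdForm.antidiagonal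 3).over L) x) : ℝ) : ℂ)) (fun x : (quasiSplit (↥(maximalRealSubfield L)) L (IsCMField.complexConj L) 3).Adelic => ((η i (adelicVal (↥(maximalRealSubfield L)) L (IsCMField.complexConj L) 3 ((StdForm.antidiagonal 3).over L) x) : ℝ) : ℂ)) y) i y).re : ℝ)) : ℂ) * u (g * y) ∂νG :=
      fun i => exists_evalCLM μ νG (n + 4) (h := fun x => ((fun (i : I) (y : (quasiSplit (↥(maximalRealSubfield L)) L (IsCMField.complexConj L) 3).Adelic) => orbitalSmoothing νG (fun x : (quasiSplit (↥(maximalRealSubfield L)) L (IsCMField.complexConj L) 3).Adelic => ((η i (adelicVal (↥(maximalRealSubfield L)) L (IsCMField.complexConj L) 3 ((StdForm.antidiagonal 3).over L) x) : ℝ) : ℂ)) (fun x : (quasiSplit (↥(maximalRealSubfield L)) L (IsCMField.complexConj L) 3).Adelic => ((η i (adelicVal (↥(maximalRealSubfield L)) L (IsCMField.complexConj L) 3 ((StdForm.antidiagonal 3).over L) x) : ℝ) : ℂ)) y) i x).re) (Complex.continuous_re.comp (hconv i).1) ((hconv i).2.1.comp_left Complex.zero_re) g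
    choose Λ hΛ using hΛex
    have hΛu : ∀ j (u : (quasiSplit (↥(maximalRealSubfield L)) L (IsCMField.complexConj L) 3).Adelic → ℂ) (huG : ∀ γ ∈ (quasiSplit (↥(maximalRealSubfield L)) L (IsCMField.complexConj L) 3).quotientSubgroup, ∀ y, u (γ * y) = u y) (hu : MemLp ((quasiSplit (↥(maximalRealSubfield L)) L (IsCMField.complexConj L) 3).quotFun u) 2 (μ.withDensity fun x => (((supHeight (↥(maximalRealSubfield L)) L (IsCMField.complexConj L) 3 x)⁻¹ ^ (2 * (n + 4)) : ℝ≥0) : ℝ≥0∞))),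
        Λ j (toHX (↥(maximalRealSubfield L)) L (IsCMField.complexConj L) 3 (n + 4) μ u hu) = ∫ y, (fun (i : I) (y : (quasiSplit (↥(maximalRealSubfield L)) L (IsCMField.complexConj L) 3).Adelic) => orbitalSmoothing νG (fun x : (quasiSplit (↥(maximalRealSubfield L)) L (IsCMField.complexConj L) 3).Adelic => ((η i (adelicVal (↥(maximalRealSubfield L)) L (IsCMField.complexConj L) 3 ((StdForm.antidiagonal 3).over L) x) : ℝ) : ℂ)) (fun x : (quasiSplit (↥(maximalRealSubfield L)) L (IsCMField.complexConj L) 3).Adelic => ((η i (adelicVal (↥(maximalRealSubfield L)) L (IsCMField.complexConj L) 3 ((StdForm.antidiagonal 3).over L) x) : ℝ) : ℂ)) y) j y * u (g * y) ∂νG := fun j u huG hu => by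
      rw [(hΛ j u huG hu).2]
      simp only [hre]
    have hzk : ∀ z ∈ Metric.ball (0 : ℂ) (n + 2), z.re ≤ ((n + 4 : ℕ) : ℝ) := fun z hz => by
      have h1 : z.re ≤ ‖z‖ := Complex.re_le_norm z
      have h2 : ‖z‖ < n + 2 := mem_ball_zero_iff.1 hz
      push_cast
      linarith
    have hΛ' : ∀ i, ∀ z ∈ Metric.ball (0 : ℂ) (n + 2), (2 : ℝ) < z.re → Λ i (eX z) = (ŝ i z) * (fun s => eisensteinSeriesU (flatSectionU φ s) g) z := by
      intro i z hz hz1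
      have hEz := eisensteinSeriesU_flatSectionU_memHX_of_norm_le_cm_three L ν h𝓕N h𝓕c μ hφc hφM (hφ.toAdelic_mul hχ₂) (n + 4) hz1 (hzk z hz)
      have heq : eX z = toHX (↥(maximalRealSubfield L)) L (IsCMField.complexConj L) 3 (n + 4) μ (eisensteinSeriesU (flatSectionU φ z)) hEz :=
        Lp.ext ((heXae z hz hz1).trans (by unfold toHX; exact (MemLp.coeFn_toLp hEz).symm))
      rw [heq, hΛu i _ (eisensteinSeriesU_flatSectionU_quotientSubgroup_mul_of_borelU_invariant L (hφ.toAdelic_mul hχ₂) z) hEz]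
      exact hev z hz1 i g
    obtain ⟨Ec, hEcm, hEcg, hgerm, hord⟩ := hrepr (fun s => eisensteinSeriesU (flatSectionU φ s) g) Λ hΛ'
    have hΛv : ∀ j s, Λ j (vX s) = ∫ y, (fun (i : I) (y : (quasiSplit (↥(maximalRealSubfield L)) L (IsCMField.complexConj L) 3).Adelic) => orbitalSmoothing νG (fun x : (quasiSplit (↥(maximalRealSubfield L)) L (IsCMField.complexConj L) 3).Adelic => ((η i (adelicVal (↥(maximalRealSubfield L)) L (IsCMField.complexConj L) 3 ((StdForm.antidiagonal 3).over L) x) : ℝ) : ℂ)) (fun x : (quasiSplit (↥(maximalRealSubfield L)) L (IsCMField.complexConj L) 3).Adelic => ((η i (adelicVal (↥(maximalRealSubfield L)) L (IsCMField.complexConj L) 3 ((StdForm.antidiagonal 3).over L) x) : ℝ) : ℂ)) y) j y * ((vX s : HX (↥(maximalRealSubfield L)) L (IsCMField.complexConj L) 3 (n + 4) μ) : (quasiSplit (↥(maximalRealSubfield L)) L (IsCMField.complexConj L) 3).automorphicQuotient → ℂ) ((quasiSplit (↥(maximalRealSubfield L)) L (IsCMField.complexConj L) 3).toAutomorphicQuotient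 (g * y)⁻¹) ∂νG := by
      intro j s
      have hmem : MemLp ((quasiSplit (↥(maximalRealSubfield L)) L (IsCMField.complexConj L) 3).quotFun (fun y : (quasiSplit (↥(maximalRealSubfield L)) L (IsCMField.complexConj L) 3).Adelic => ((vX s : HX (↥(maximalRealSubfield L)) L (IsCMField.complexConj L) 3 (n + 4) μ) : (quasiSplit (↥(maximalRealSubfield L)) L (IsCMField.complexConj L) 3).automorphicQuotient → ℂ) ((quasiSplit (↥(maximalRealSubfield L)) L (IsCMField.complexConj L) 3).toAutomorphicQuotient y⁻¹))) 2 (μ.withDensity fun x => (((supHeight (↥(maximalRealSubfield L)) L (IsCMField.complexConj L) 3 x)⁻¹ ^ (2 * (n + 4)) : ℝ≥0) : ℝ≥0∞)) := by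
        rw [quotFun_lift]; exact Lp.memLp (vX s)
      have htoHX : toHX (↥(maximalRealSubfield L)) L (IsCMField.complexConj L) 3 (n + 4) μ (fun y : (quasiSplit (↥(maximalRealSubfield L)) L (IsCMField.complexConj L) 3).Adelic => ((vX s : HX (↥(maximalRealSubfield L)) L (IsCMField.complexConj L) 3 (n + 4) μ) : (quasiSplit (↥(maximalRealSubfield L)) L (IsCMField.complexConj L) 3).automorphicQuotient → ℂ) ((quasiSplit (↥(maximalRealSubfield L)) L (IsCMField.complexConj L) 3).toAutomorphicQuotient y⁻¹)) hmem = vX s := by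
        have key : ∀ (f : (quasiSplit (↥(maximalRealSubfield L)) L (IsCMField.complexConj L) 3).automorphicQuotient → ℂ) (hf : MemLp f 2 (μ.withDensity fun x => (((supHeight (↥(maximalRealSubfield L)) L (IsCMField.complexConj L) 3 x)⁻¹ ^ (2 * (n + 4)) : ℝ≥0) : ℝ≥0∞))), f = ((vX s : HX (↥(maximalRealSubfield L)) L (IsCMField.complexConj L) 3 (n + 4) μ) : (quasiSplit (↥(maximalRealSubfield L)) L (IsCMField.complexConj L) 3).automorphicQuotient → ℂ) → hf.toLp f = vX s := by
          rintro f hf rfl; exact Lp.toLp_coeFn _ _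
        exact key _ hmem (quotFun_lift _)
      have e := hΛu j (fun y : (quasiSplit (↥(maximalRealSubfield L)) L (IsCMField.complexConj L) 3).Adelic => ((vX s : HX (↥(maximalRealSubfield L)) L (IsCMField.complexConj L) 3 (n + 4) μ) : (quasiSplit (↥(maximalRealSubfield L)) L (IsCMField.complexConj L) 3).automorphicQuotient → ℂ) ((quasiSplit (↥(maximalRealSubfield L)) L (IsCMField.complexConj L) 3).toAutomorphicQuotient y⁻¹)) (lift_quotientSubgroup_mul _) hmem
      rw [htoHX] at e
      exact e
    exact ⟨Ec, hEcm, hEcg, hord, fun j z hz hne => (hgerm j z hz hne).trans (Filter.Eventually.of_forall fun s => by simp only [hΛv])⟩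

end Summit.HodgeConjecture.HodgeConjecture.Cruxes.H413.K2E1ChiEisensteinBallPackageCMThreeEigen
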